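import Literature.Probability.LatticeModels.IsingPeierls
import HarnessLib

/-!
# REVIEW-RUNBOOK sanity lemmas — the infimum defining `β_c(d)` is a GENUINE infimum for `d ≥ 2`
# (client `pub-corpus` of the ops review-runbook generator; §2 card `Literature.Probability.LatticeModels.criticalBeta`)

`criticalBeta d = sInf {β : ℝ | 0 ≤ β ∧ 0 < spontaneousMagnetization d β}` (Friedli–Velenik Def. 3.29).  Mathlib's `sInf`
on `ℝ` is the DEFAULT `0` for an empty or unbounded-below set.  The set is bounded below by `0` by its very definition, and
for `d ≥ 2` it is NON-EMPTY: the tree PROVES Peierls' estimate (`IsingPeierls.lean`,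
`exists_spontaneousMagnetization_pos_holds`: `m*(4) ≥ ½ > 0` in every dimension `d ≥ 2`).  For `d ≤ 1` the set IS empty and
`criticalBeta d = 0` is the documented junk value (docstring of `criticalBeta`); every statement of the runbooks assumes
`2 ≤ d`.

Review evidence only (topic module, closes no item); no definitions, no `sorry`, standard axioms.
-/

namespace Summit.CriticalPhenomena.Ising3D.Runbook

open Literature.Probability.LatticeModels

/-- (c) **The defining set of `β_c(d)` is bounded below** — by `0`, in every dimension (its members are `≥ 0` by definition).
[folklore] -/
theorem criticalBeta_set_bddBelow (d : ℕ) :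
    BddBelow {β : ℝ | 0 ≤ β ∧ 0 < spontaneousMagnetization d β} :=
  ⟨0, fun _ hβ => hβ.1⟩

/-- (c) **The defining set of `β_c(d)` is non-empty for `d ≥ 2`**: `β = 4` has positive spontaneous magnetisation
(Peierls — the tree's `exists_spontaneousMagnetization_pos_holds`). [folklore] -/
theorem criticalBeta_set_nonempty {d : ℕ} (hd : 2 ≤ d) :
    {β : ℝ | 0 ≤ β ∧ 0 < spontaneousMagnetization d β}.Nonempty :=
  exists_spontaneousMagnetization_pos_holds (d := d) hd

/-- Both at once, in the shape the side-fact ledger prints: for `d ≥ 2` the infimum in `criticalBeta d` is taken over a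
non-empty set bounded below — `β_c(d)` is a genuine infimum, not the default `0`. [folklore] -/
theorem criticalBeta_bddBelow_nonempty {d : ℕ} (hd : 2 ≤ d) :
    BddBelow {β : ℝ | 0 ≤ β ∧ 0 < spontaneousMagnetization d β} ∧
      {β : ℝ | 0 ≤ β ∧ 0 < spontaneousMagnetization d β}.Nonempty :=
  ⟨criticalBeta_set_bddBelow d, criticalBeta_set_nonempty hd⟩

/-- Hence `β_c(d) ≤ 4` for `d ≥ 2` (the infimum lies below the Peierls witness). [folklore] -/
theorem criticalBeta_le_four {d : ℕ} (hd : 2 ≤ d) : criticalBeta d ≤ 4 :=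
  csInf_le (criticalBeta_set_bddBelow d)
    ⟨by norm_num, lt_of_lt_of_le (by norm_num) (half_le_spontaneousMagnetization hd le_rfl)⟩

end Summit.CriticalPhenomena.Ising3D.Runbook
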